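import Mathlib.MeasureTheory.Measure.MeasureSpace
import Mathlib.MeasureTheory.Measure.Typeclasses.Probability
import HarnessLib

/-!
# Exponential tails for the number of meetings from a decoupling inequality

The abstract probabilistic mechanism by which *unpredictable* paths have exponential
intersection tails: I. Benjamini, R. Pemantle, Y. Peres, *Unpredictable paths and percolation*,
Ann. Probab. **26** (1998) 1198–1211 (arXiv:math/9701227), **Lemma 3.1** ("a summable
predictability profile yields EIT": if `∑_k pr_Γ(k) < ∞` then the number of collisions
`#{n : Γ_n = v_n}` with any fixed sequence has an exponential tail, uniformly in the sequence);
used by Garban–Spencer, arXiv:2109.01617, Theorem 2.4, for the path measures of their proof of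
Theorem 1.3.  We prove a variant phrased for two-sided "meeting events" with a *decoupling
inequality* in a filtration, which is the form in which the predictability profile enters.
Setting: a measure `P`, a filtration `ℱ s` ("information strictly before time `s`"), *meeting
events* `M t ∈ ℱ t`, and a **decoupling inequality** with a profile `g`:

  `P (E ∩ M (s + r)) ≤ g r · P E`   for every `E ∈ ℱ s`

(for unpredictable walks: a meeting at time `s + r` requires the fresh randomness revealed in
`[s, s + r)` to hit a bounded window, which has conditional probability `≤ g r` whatever happened
before `s`).  If the profile has uniformly small tails, `∑_{L ≤ r < n} g r ≤ G` for all `n`, then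
the number `N = #{t < n : M t}` of meetings satisfies, uniformly in the horizon `n`,

  `P (N ≥ L·(j+1) + 1) ≤ P (N_{[L,n)} ≥ L·j + 1) ≤ G^{j+1} · P univ`   (`measure_meetCount_ge_le`),

i.e. exponential tails as soon as `G < 1` (BPP choose the spacing `m` with `∑_k pr(km) < 1` and
argue along residue classes mod `m`; we organise the same idea as an induction that only
conditions on the *first* meeting after a given time, so that no stopping-time machinery is
needed): the event is covered by the disjoint `ℱ_t`-events "the first meeting after `a + L`
happens at `t`" intersected with "at least `L(j−1)+1` meetings after `t + L`", to which the
induction hypothesis applies (`measure_inter_meetCount_ge_le`).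

Everything here is elementary measure theory; no lattice model appears.

## References

* I. Benjamini, R. Pemantle, Y. Peres, Ann. Probab. 26 (1998) 1198–1211 = arXiv:math/9701227,
  §3, Lemma 3.1 and the proof of Theorem 1.3 (read in the arXiv version, pp. 3 and 6).
  [BenjaminiPemantlePeres1998]
* C. Garban, T. Spencer, J. Math. Phys. 63 (2022) 093302, arXiv:2109.01617, Theorem 2.4.
  [GarbanSpencer2022]
-/

noncomputable section

open MeasureTheory Finset Set
open scoped ENNReal

namespace Literature.Probability.LatticeModels

variable {Ω : Type*}

/-! ### Counting meetings -/

open Classical in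
/-- The number of meeting times `t ∈ [a, n)` of the trajectory `ω`: `#{t ∈ [a,n) : ω ∈ M t}`.
[folklore] -/
def meetCount (M : ℕ → Set Ω) (a n : ℕ) (ω : Ω) : ℕ :=
  #{t ∈ Finset.Ico a n | ω ∈ M t}

/-- No meetings in an empty window. [folklore] -/
theorem meetCount_of_le (M : ℕ → Set Ω) {a n : ℕ} (h : n ≤ a) (ω : Ω) : meetCount M a n ω = 0 := by
  simp [meetCount, Finset.Ico_eq_empty_of_le h]

/-- Splitting the window: `N_{[a,n)} = N_{[a,b)} + N_{[b,n)}` for `a ≤ b ≤ n`. [folklore] -/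
theorem meetCount_add (M : ℕ → Set Ω) {a b n : ℕ} (hab : a ≤ b) (hbn : b ≤ n) (ω : Ω) :
    meetCount M a n ω = meetCount M a b ω + meetCount M b n ω := by
  classical
  unfold meetCount
  rw [← Finset.card_union_of_disjoint, ← Finset.filter_union, Finset.Ico_union_Ico_eq_Ico hab hbn]
  exact Finset.disjoint_filter_filter (Finset.Ico_disjoint_Ico_consecutive a b n)

/-- At most `n − a` meetings in `[a, n)`. [folklore] -/
theorem meetCount_le (M : ℕ → Set Ω) (a n : ℕ) (ω : Ω) : meetCount M a n ω ≤ n - a := by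
  classical
  unfold meetCount
  exact (Finset.card_filter_le _ _).trans (by simp)

open Classical in
/-- The count on `[b, b+1)` is the indicator of a meeting at `b`. [folklore] -/
theorem meetCount_succ_self (M : ℕ → Set Ω) (b : ℕ) (ω : Ω) :
    meetCount M b (b + 1) ω = if ω ∈ M b then 1 else 0 := by
  unfold meetCount
  rw [Nat.Ico_succ_singleton, Finset.filter_singleton]
  split_ifs <;> simp

/-- A window without meetings counts zero. [folklore] -/
theorem meetCount_eq_zero (M : ℕ → Set Ω) {a n : ℕ} {ω : Ω} (h : ∀ t, a ≤ t → t < n → ω ∉ M t) :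
    meetCount M a n ω = 0 := by
  classical
  unfold meetCount
  rw [Finset.card_eq_zero, Finset.filter_eq_empty_iff]
  intro t ht
  rw [Finset.mem_Ico] at ht
  exact h t ht.1 ht.2

/-- A positive count produces a **first meeting**: if `N_{[a,n)} ≥ 1` there is `t ∈ [a,n)` with
`ω ∈ M t` and no meeting in `[a, t)`. [folklore] -/
theorem exists_first_meeting (M : ℕ → Set Ω) {a n : ℕ} {ω : Ω} (h : 1 ≤ meetCount M a n ω) :
    ∃ t, a ≤ t ∧ t < n ∧ ω ∈ M t ∧ meetCount M a t ω = 0 := by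
  classical
  have hne : ({t ∈ Finset.Ico a n | ω ∈ M t} : Finset ℕ).Nonempty := by
    rw [← Finset.card_pos]; exact h
  obtain ⟨t, ht⟩ := Finset.min_of_nonempty hne
  have hmem := Finset.mem_of_min ht
  simp only [Finset.mem_filter, Finset.mem_Ico] at hmem
  refine ⟨t, hmem.1.1, hmem.1.2, hmem.2, meetCount_eq_zero M fun t' h1 h2 h3 => ?_⟩
  have : t' ∈ ({t ∈ Finset.Ico a n | ω ∈ M t} : Finset ℕ) := by
    simp only [Finset.mem_filter, Finset.mem_Ico]
    exact ⟨⟨h1, h2.trans hmem.1.2⟩, h3⟩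
  exact absurd (Finset.min_le_of_eq this ht) (not_le.2 h2)

/-! ### Measurability of the counting events in the filtration -/

/-- Level sets `{N_{[a,b)} ≥ k}` are `ℱ_s`-events as soon as `b ≤ s` (each `M t`, `t < b`, is an
`ℱ_t ⊆ ℱ_s`-event). [folklore] -/
theorem measurableSet_le_meetCount {ℱ : ℕ → MeasurableSpace Ω} (hℱ : Monotone ℱ) {M : ℕ → Set Ω}
    (hM : ∀ t, MeasurableSet[ℱ t] (M t)) (a : ℕ) :
    ∀ (b s : ℕ), b ≤ s → ∀ k : ℕ, MeasurableSet[ℱ s] {ω | k ≤ meetCount M a b ω}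
  | 0, s, _, k => by
    rcases Nat.eq_zero_or_pos k with rfl | hk
    · have : {ω | 0 ≤ meetCount M a 0 ω} = Set.univ := by ext ω; simp
      rw [this]; exact @MeasurableSet.univ Ω (ℱ s)
    · have : {ω | k ≤ meetCount M a 0 ω} = ∅ := by
        ext ω; simp [meetCount_of_le M (Nat.zero_le a)]
        omega
      rw [this]; exact @MeasurableSet.empty Ω (ℱ s)
  | b + 1, s, hbs, k => by
    classical
    by_cases hab : a ≤ b
    · have e : {ω | k ≤ meetCount M a (b + 1) ω} =
          {ω | k ≤ meetCount M a b ω} ∪ (M b ∩ {ω | k ≤ meetCount M a b ω + 1}) := by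
        ext ω
        simp only [Set.mem_setOf_eq, Set.mem_union, Set.mem_inter_iff]
        rw [meetCount_add M hab (Nat.le_succ b), meetCount_succ_self]
        split_ifs with h
        · constructor
          · intro hk; exact Or.inr ⟨h, hk⟩
          · rintro (hk | ⟨-, hk⟩) <;> omega
        · simp [h]
      rw [e]
      refine (measurableSet_le_meetCount hℱ hM a b s ((Nat.le_succ b).trans hbs) k).union
        ((hℱ ((Nat.le_succ b).trans hbs) _ (hM b)).inter ?_)
      rcases Nat.eq_zero_or_pos k with rfl | hk
      · have : {ω | 0 ≤ meetCount M a b ω + 1} = Set.univ := by ext ω; simp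
        rw [this]; exact @MeasurableSet.univ Ω (ℱ s)
      · have e2 : {ω | k ≤ meetCount M a b ω + 1} = {ω | k - 1 ≤ meetCount M a b ω} := by
          ext ω; simp only [Set.mem_setOf_eq]; omega
        rw [e2]
        exact measurableSet_le_meetCount hℱ hM a b s ((Nat.le_succ b).trans hbs) (k - 1)
    · push Not at hab
      have e : ∀ ω, meetCount M a (b + 1) ω = 0 := meetCount_of_le M (by omega)
      rcases Nat.eq_zero_or_pos k with rfl | hk
      · have : {ω | 0 ≤ meetCount M a (b + 1) ω} = Set.univ := by ext ω; simp
        rw [this]; exact @MeasurableSet.univ Ω (ℱ s)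
      · have : {ω | k ≤ meetCount M a (b + 1) ω} = ∅ := by
          ext ω; simp [e ω]; omega
        rw [this]; exact @MeasurableSet.empty Ω (ℱ s)

/-- The event "no meeting in `[a,b)`" is an `ℱ_s`-event for `b ≤ s`. [folklore] -/
theorem measurableSet_meetCount_eq_zero {ℱ : ℕ → MeasurableSpace Ω} (hℱ : Monotone ℱ) {M : ℕ → Set Ω}
    (hM : ∀ t, MeasurableSet[ℱ t] (M t)) {a b s : ℕ} (hbs : b ≤ s) :
    MeasurableSet[ℱ s] {ω | meetCount M a b ω = 0} := by
  have e : {ω | meetCount M a b ω = 0} = {ω | 1 ≤ meetCount M a b ω}ᶜ := by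
    ext ω; simp only [Set.mem_setOf_eq, Set.mem_compl_iff]; omega
  rw [e]
  exact (measurableSet_le_meetCount hℱ hM a b s hbs 1).compl

/-! ### The tail bound -/

section Tail

variable {mΩ : MeasurableSpace Ω} (P : Measure Ω) {ℱ : ℕ → MeasurableSpace Ω} {M : ℕ → Set Ω}
  {g : ℕ → ℝ≥0∞} {L : ℕ} {G : ℝ≥0∞}

/-- **One meeting costs a factor `G`**: for `E ∈ ℱ_a`,
`P (E ∩ {some meeting in [a+L, n)}) ≤ ∑_{L ≤ r < n} P (E ∩ M (a+r)) ≤ G · P E`. [folklore] -/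
theorem measure_inter_exists_meeting_le
    (hdec : ∀ (s r : ℕ) (E : Set Ω), MeasurableSet[ℱ s] E → P (E ∩ M (s + r)) ≤ g r * P E)
    (hG : ∀ n, ∑ r ∈ Finset.Ico L n, g r ≤ G) (n a : ℕ) {E : Set Ω} (hE : MeasurableSet[ℱ a] E) :
    P (E ∩ {ω | 1 ≤ meetCount M (a + L) n ω}) ≤ G * P E := by
  have hsub : E ∩ {ω | 1 ≤ meetCount M (a + L) n ω} ⊆ ⋃ r ∈ Finset.Ico L n, (E ∩ M (a + r)) := by
    rintro ω ⟨hE', hω⟩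
    obtain ⟨t, h1, h2, h3, -⟩ := exists_first_meeting M hω
    simp only [Set.mem_iUnion, Finset.mem_Ico, Set.mem_inter_iff, exists_prop]
    exact ⟨t - a, ⟨by omega, by omega⟩, hE', by rwa [Nat.add_sub_cancel' (by omega)]⟩
  calc P (E ∩ {ω | 1 ≤ meetCount M (a + L) n ω})
      ≤ P (⋃ r ∈ Finset.Ico L n, (E ∩ M (a + r))) := measure_mono hsub
    _ ≤ ∑ r ∈ Finset.Ico L n, P (E ∩ M (a + r)) := measure_biUnion_finset_le _ _
    _ ≤ ∑ r ∈ Finset.Ico L n, g r * P E := Finset.sum_le_sum fun r _ => hdec a r E hE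
    _ = (∑ r ∈ Finset.Ico L n, g r) * P E := by rw [Finset.sum_mul]
    _ ≤ G * P E := by gcongr; exact hG n

/-- **The induction**: for `E ∈ ℱ_a`,
`P (E ∩ {N_{[a+L,n)} ≥ L·j + 1}) ≤ G^{j+1} · P E` — decompose according to the first meeting
`t ≥ a + L` (disjoint `ℱ_t`-events), leave a gap `L`, and apply the case `j − 1` inside `ℱ_t`.
[cite: BenjaminiPemantlePeres1998, Lemma 3.1 (variant)] -/
theorem measure_inter_meetCount_ge_le (hℱ : Monotone ℱ) (hℱle : ∀ s, ℱ s ≤ mΩ)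
    (hM : ∀ t, MeasurableSet[ℱ t] (M t))
    (hdec : ∀ (s r : ℕ) (E : Set Ω), MeasurableSet[ℱ s] E → P (E ∩ M (s + r)) ≤ g r * P E)
    (hG : ∀ n, ∑ r ∈ Finset.Ico L n, g r ≤ G) (n : ℕ) :
    ∀ (j a : ℕ) (E : Set Ω), MeasurableSet[ℱ a] E →
      P (E ∩ {ω | L * j + 1 ≤ meetCount M (a + L) n ω}) ≤ G ^ (j + 1) * P E
  | 0, a, E, hE => by
    simpa only [Nat.mul_zero, Nat.zero_add, pow_one] using
      measure_inter_exists_meeting_le P hdec hG n a hE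
  | j + 1, a, E, hE => by
    -- first-meeting decomposition
    set F : ℕ → Set Ω := fun r => M (a + r) ∩ {ω | meetCount M (a + L) (a + r) ω = 0} with hF
    have hFmeas : ∀ r, MeasurableSet[ℱ (a + r)] (E ∩ F r) := fun r =>
      (hℱ (Nat.le_add_right a r) _ hE).inter ((hM _).inter
        (measurableSet_meetCount_eq_zero hℱ hM le_rfl))
    have hsub : E ∩ {ω | L * (j + 1) + 1 ≤ meetCount M (a + L) n ω} ⊆
        ⋃ r ∈ Finset.Ico L (n - a), ((E ∩ F r) ∩ {ω | L * j + 1 ≤ meetCount M (a + r + L) n ω}) := by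
      rintro ω ⟨hE', hω⟩
      have hω' : L * (j + 1) + 1 ≤ meetCount M (a + L) n ω := hω
      obtain ⟨t, h1, h2, h3, h4⟩ := exists_first_meeting M (le_trans (by omega) hω')
      simp only [Set.mem_iUnion, Finset.mem_Ico, Set.mem_inter_iff, Set.mem_setOf_eq, exists_prop]
      refine ⟨t - a, ⟨by omega, by omega⟩, ⟨hE', ?_, ?_⟩, ?_⟩
      · show ω ∈ M (a + (t - a)); rwa [Nat.add_sub_cancel' (by omega)]
      · show meetCount M (a + L) (a + (t - a)) ω = 0; rwa [Nat.add_sub_cancel' (by omega)]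
      · rw [Nat.add_sub_cancel' (show a ≤ t by omega)]
        -- N_{[a+L,n)} = N_{[a+L,t)} + N_{[t,n)} ≤ 0 + L + N_{[t+L,n)}
        have hsplit := meetCount_add M h1 h2.le ω
        rw [h4, zero_add] at hsplit
        have hmid : meetCount M t n ω ≤ L + meetCount M (t + L) n ω := by
          by_cases htl : t + L ≤ n
          · rw [meetCount_add M (Nat.le_add_right t L) htl]
            have h5 : meetCount M t (t + L) ω ≤ L :=
              (meetCount_le M t (t + L) ω).trans_eq (Nat.add_sub_cancel_left t L)
            exact Nat.add_le_add_right h5 _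
          · have h5 := meetCount_le M t n ω
            omega
        have : L * (j + 1) + 1 ≤ L + meetCount M (t + L) n ω := hω'.trans (hsplit ▸ hmid)
        rw [Nat.mul_succ] at this
        omega
    -- disjointness of the first-meeting events
    have hdisj : Set.PairwiseDisjoint (↑(Finset.Ico L (n - a)) : Set ℕ) (fun r => E ∩ F r) := by
      intro r hr r' hr' hne
      wlog hlt : r < r' generalizing r r'
      · exact (this hr' hr hne.symm (lt_of_le_of_ne (not_lt.1 hlt) hne.symm)).symm
      rw [Function.onFun, Set.disjoint_left]
      rintro ω ⟨-, hr1, -⟩ ⟨-, -, hr'2⟩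
      have h0 : meetCount M (a + L) (a + r') ω = 0 := hr'2
      have : ω ∉ M (a + r) := by
        intro hm
        have hpos : 1 ≤ meetCount M (a + L) (a + r') ω := by
          classical
          unfold meetCount
          rw [Nat.one_le_iff_ne_zero, Ne, Finset.card_eq_zero, ← Ne, ← Finset.nonempty_iff_ne_empty]
          exact ⟨a + r, by simp only [Finset.mem_filter, Finset.mem_Ico]; exact ⟨⟨by
            have := (Finset.mem_Ico.1 hr).1; omega, by omega⟩, hm⟩⟩
        omega
      exact this hr1
    calc P (E ∩ {ω | L * (j + 1) + 1 ≤ meetCount M (a + L) n ω})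
        ≤ P (⋃ r ∈ Finset.Ico L (n - a), ((E ∩ F r) ∩ {ω | L * j + 1 ≤ meetCount M (a + r + L) n ω})) :=
          measure_mono hsub
      _ ≤ ∑ r ∈ Finset.Ico L (n - a), P ((E ∩ F r) ∩ {ω | L * j + 1 ≤ meetCount M (a + r + L) n ω}) :=
          measure_biUnion_finset_le _ _
      _ ≤ ∑ r ∈ Finset.Ico L (n - a), G ^ (j + 1) * P (E ∩ F r) :=
          Finset.sum_le_sum fun r _ =>
            measure_inter_meetCount_ge_le hℱ hℱle hM hdec hG n j (a + r) (E ∩ F r) (hFmeas r)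
      _ = G ^ (j + 1) * P (⋃ r ∈ Finset.Ico L (n - a), (E ∩ F r)) := by
          rw [← Finset.mul_sum, measure_biUnion_finset hdisj fun r _ => hℱle _ _ (hFmeas r)]
      _ ≤ G ^ (j + 1) * P (E ∩ {ω | 1 ≤ meetCount M (a + L) n ω}) := by
          gcongr
          refine Set.iUnion₂_subset fun r hr => ?_
          rintro ω ⟨hE', hm, -⟩
          refine ⟨hE', ?_⟩
          show 1 ≤ meetCount M (a + L) n ω
          classical
          unfold meetCount
          rw [Nat.one_le_iff_ne_zero, Ne, Finset.card_eq_zero, ← Ne, ← Finset.nonempty_iff_ne_empty]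
          have hr' := Finset.mem_Ico.1 hr
          refine ⟨a + r, ?_⟩
          simp only [Finset.mem_filter, Finset.mem_Ico]
          exact ⟨⟨by omega, by omega⟩, hm⟩
      _ ≤ G ^ (j + 1) * (G * P E) := by
          gcongr
          exact measure_inter_exists_meeting_le P hdec hG n a hE
      _ = G ^ (j + 1 + 1) * P E := by ring

/-- **Exponential tails for the number of meetings.** Under the decoupling inequality with a
profile whose tail sums are `≤ G` beyond `L`, for every horizon `n` and every `j`,
`P {N_{[0,n)} ≥ L(j+1) + 1} ≤ G^{j+1} · P univ` — uniformly in `n`.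
[cite: BenjaminiPemantlePeres1998, Lemma 3.1 (variant)] -/
theorem measure_meetCount_ge_le (hℱ : Monotone ℱ) (hℱle : ∀ s, ℱ s ≤ mΩ)
    (hM : ∀ t, MeasurableSet[ℱ t] (M t))
    (hdec : ∀ (s r : ℕ) (E : Set Ω), MeasurableSet[ℱ s] E → P (E ∩ M (s + r)) ≤ g r * P E)
    (hG : ∀ n, ∑ r ∈ Finset.Ico L n, g r ≤ G) (n j : ℕ) :
    P {ω | L * (j + 1) + 1 ≤ meetCount M 0 n ω} ≤ G ^ (j + 1) * P Set.univ := by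
  have hsub : {ω | L * (j + 1) + 1 ≤ meetCount M 0 n ω} ⊆
      Set.univ ∩ {ω | L * j + 1 ≤ meetCount M (0 + L) n ω} := by
    intro ω hω
    refine ⟨Set.mem_univ ω, ?_⟩
    have hω' : L * (j + 1) + 1 ≤ meetCount M 0 n ω := hω
    show L * j + 1 ≤ meetCount M (0 + L) n ω
    rw [Nat.zero_add]
    have hmid : meetCount M 0 n ω ≤ L + meetCount M L n ω := by
      by_cases hL : L ≤ n
      · rw [meetCount_add M (Nat.zero_le L) hL]
        have h5 : meetCount M 0 L ω ≤ L := (meetCount_le M 0 L ω).trans_eq (Nat.sub_zero L)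
        exact Nat.add_le_add_right h5 _
      · have h5 := meetCount_le M 0 n ω
        omega
    rw [Nat.mul_succ] at hω'
    omega
  exact (measure_mono hsub).trans
    (measure_inter_meetCount_ge_le P hℱ hℱle hM hdec hG n j 0 Set.univ MeasurableSet.univ)

/-- **Exponential tails, threshold form**: `P {N_{[0,n)} ≥ k} ≤ G^{⌊(k−1)/L⌋} · P univ` for
every `k` and every horizon `n`. [cite: BenjaminiPemantlePeres1998, Lemma 3.1 (variant)] -/
theorem measure_meetCount_ge_le_pow_div (hℱ : Monotone ℱ) (hℱle : ∀ s, ℱ s ≤ mΩ)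
    (hM : ∀ t, MeasurableSet[ℱ t] (M t))
    (hdec : ∀ (s r : ℕ) (E : Set Ω), MeasurableSet[ℱ s] E → P (E ∩ M (s + r)) ≤ g r * P E)
    (hG : ∀ n, ∑ r ∈ Finset.Ico L n, g r ≤ G) (n k : ℕ) :
    P {ω | k ≤ meetCount M 0 n ω} ≤ G ^ ((k - 1) / L) * P Set.univ := by
  rcases Nat.eq_zero_or_pos ((k - 1) / L) with hq | hq
  · rw [hq, pow_zero, one_mul]; exact measure_mono (Set.subset_univ _)
  · obtain ⟨j, hj⟩ : ∃ j, (k - 1) / L = j + 1 := ⟨(k - 1) / L - 1, by omega⟩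
    rw [hj]
    refine (measure_mono fun ω hω => ?_).trans (measure_meetCount_ge_le P hℱ hℱle hM hdec hG n j)
    have hk : L * (j + 1) + 1 ≤ k := by
      have h1 : (k - 1) / L * L ≤ k - 1 := Nat.div_mul_le_self (k - 1) L
      rw [hj] at h1
      have hk1 : 1 ≤ k := by
        by_contra h0
        push Not at h0
        have : k - 1 = 0 := by omega
        rw [this, Nat.zero_div] at hj
        omega
      have h2 : L * (j + 1) ≤ k - 1 := by rwa [mul_comm] at h1
      generalize L * (j + 1) = q at h2 ⊢
      omega
    exact hk.trans hω

end Tail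

end Literature.Probability.LatticeModels
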